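import Summits.QuantumFields.BalabanUV.Beta.GAN24.CombChargeRowsHold
import Summits.QuantumFields.BalabanUV.Beta.D1BFx.ShellRoadEndMean
import Summits.QuantumFields.BalabanUV.Beta.D1BFx.SbpScalarEndMean
import Summits.QuantumFields.BalabanUV.Beta.RowD1TelescopingBounded

/-!
# `BalabanUV.Beta.GAN24.CombTowerEndRowD1MeanTable` — binder row G-an2-4 ∕ (CONV-C) → row D1, TRANSFER-III: **THE (III′) END OF RECORD (HOLD) PLUGGED INTO road «BF-x»'s
# MEAN-GRADING ENDs IN TABLE CURRENCY AND INTO an2's GENERIC «TWO OUT OF THREE», FOR an2's (III′) LITERAL OF RECORD `JsB12CombShSym hLc N (symTablesAn1S2 3 Lc cΛ) cΛ cB`,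
# WITH NO G-an2-4 ROW LEFT** — the part of the (E) consumer trio (MY g78 `RowD1LiteralOfTowerEnd` §3 ∕ road-P2 g54's J-54 `WrecAtEvenHalfRowsOfTowerEndMean` §2 ∕ the OWNER g45's
# `TowerEndRowD1Sockets` §4) NOT covered by the OWNER gan24-p1 g56's `CombTowerEndRowD1Sockets` ([GAN24P1-G56-INTENT-1]: `tendsto ∕ geomRate ∕ iff_tendsto_stepBal ∕ iff_cesaro ∕ of_step_law_* ∕
# of_meanRoad ∕ endpointExistence_*`), importing HOLD `CombChargeRowsHold` (p609000 ✓) directly; NO statement of HOLD or of the OWNER's file is re-declared.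
# (G-an2-4 formalisation swarm, leaf prover `b2b-balaban-gan24-formalise-leaf-01` gen 91, [LEAF01-G91-INTENT-2] (M1); NOT asked by an2 (W-4 l.64553) — zero-weight junctions over DISPLAYED sockets)

NOT IN PRINT; OUR BOOKKEEPING ([folklore] composition BY NAME; 0 `def`, 0 cited facts, 0 `def … : Prop`, 0 sorry).  HONEST FRAMING (cell contract, verbatim):
«discharging `BetaPertH` makes Bałaban's UV stability UNCONDITIONAL — a real constructive-QFT result; it is NOT the continuum limit and NOT the Clay problem.»
HONEST DEPENDENCY (verbatim): «continuum YM on T⁴ ⇐ BetaPertH ∧ nine spine estimates (0/9 proved); BetaPertH ⇐ (D1) ∧ (D4) ∧ CAP+tail; G-an2-4 gates asym,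
D1 and NE2/3/4.»

WHAT (`d + 1 = 4`; `Lc` odd, `2 ≤ Lc`; Wilson colour `2 ≤ N`; the two pins of HOLD `cΛ·Lc⁴ = 2`, `cB = −Lc¹²∕4`; `β⁰_j := secondMoment (TbalOf Lc (JsB12CombShSym hLc N (symTablesAn1S2 3 Lc cΛ) cΛ cB) j) μ ν`;
the slope parameter `Nc : ℝ` of `D1Drift` FREE against the `SU(N)` of the record):
* §1 road «BF-x»'s MEAN ROAD ENDs IN TABLE CURRENCY at the (III′) literal, the all-scales binders `hall ∕ hθ0 ∕ hθ1` SUPPLIED by HOLD §1 `exists_allScalesSeq_JsB12CombShSym_an1` BY NAME: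
  **`d1Drift_JsB12CombShSym_an1_of_meanRoad_table`** ((B1_mean) + the MEAN table target over a scalar leg family `Gf` with convex base-point weights + an3's six pointwise scalar rows
  `h0 h1 h2 d0 d1 d2` ⟹ `D1Drift`; `RoadEnd.d1Drift_of_meanRoad_table`), **`…_of_meanRoad_table_shell`** (the mixed second-difference rows in SHELL-ℓ¹ form `h2s ∕ d2s`;
  `ShellRoadEndMean.d1Drift_of_meanRoad_table_shell`), **`…_of_meanRoad_table_sbp`** (NO second-difference row, «C3-SBP»: the four first-order rows `h0 h1 d0 d1`;
  `SbpScalarEndMean.d1Drift_of_meanRoad_table_sbp`).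
* §2 an2's «TWO OUT OF THREE» among `D1Drift`, `D1Rep`, bounded read-out defect, for ANY composite family `Jc : ∀ m, JetData 3 (Lc^m)` (the (III′) literal has NO composite family of
  record in the tree — `Jc` is DISPLAYED), with NO half-kernel letter: **`readoutBdd_iff_lim_eq_of_D1Rep`** (GIVEN `D1Rep Lc Jc …` + the standing data, the bounded read-out defect of `β⁰`
  against `TshotOf Lc Jc` ⟺ `CauchyRate.lim β⁰ = stepBal Nc Lc`; `RowD1TelescopingBounded.d1Drift_of_readoutBdd_D1Rep ∕ readoutBdd_of_D1Drift_D1Rep` ⨾ HOLD §2) and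
  **`d1Rep_iff_readoutBdd_of_lim_eq`** (GIVEN the identification, `D1Rep Lc Jc …` ⟺ the bounded read-out defect; `d1Rep_of_D1Drift_readoutBdd`).
READING (zero weight beyond the composition): every displayed binder below is ROW D1's ((B1_mean), the MEAN table targets, an3's scalar rows, `D1Rep`, the identification, the printed B5
Props BY NAME) — NONE is row G-an2-4's.  Discharges NOTHING of row D1's debt; NOT «D1 closed»; NEVER «G-an2-4 closed» as (CONV-C) (HOLD is a statement about THIS chart of record — the
U = 1 constituent at an1's sym tables —, not about the fine-lattice constituents); NOT `BetaPertH`, NOT continuum, NOT Clay.  2026-08-28; no existing file touched.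
-/

noncomputable section

open Finset Filter Topology
open scoped BigOperators
open Literature.Probability.LatticeModels (annulus)
open Literature.MathematicalPhysics.QuantumFieldTheory
open Literature.MathematicalPhysics.QuantumFieldTheory.Balaban1983to89
open Literature.MathematicalPhysics.QuantumFieldTheory.Balaban1983to89.Beta
open RemainderConstAllScales (AllScalesSeq)
open RateCertificate (CauchyRate)
open OneStepResolventKernel (JetData)
open OneStepKernelFamily (TbalOf TshotOf D1Rep D1Drift)
open B12Beta (secondMoment)
open B12Normalization (stepBal)
open WindowIdentification (fullSum)
open DyadicShell (Pt supNorm)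
open SquareTable (stK)
open GhostTable (gFree)
open BubbleTransfer (unitVec)
open Literature.MathematicalPhysics.QuantumFieldTheory.Balaban1983to89.Beta.VectorTailsLoc (fam kfam)
open Literature.MathematicalPhysics.QuantumFieldTheory.Balaban1983to89.Beta.VectorLegVolumeAdapter (MvE)
open Summit.QuantumFields.BalabanUV.Beta.CombChartJointEnd (JsB12CombShSym)
open Summit.QuantumFields.BalabanUV.Beta.SymSecondOrderTablesAn1 (symTablesAn1S2)
open Summit.QuantumFields.BalabanUV.Beta.GAN24.CombChargeRowsHold (exists_allScalesSeq_JsB12CombShSym_an1 d1Drift_JsB12CombShSym_an1_iff_lim_eq)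
open Summit.QuantumFields.BalabanUV.Beta.D1BFx.RoadEnd (d1Drift_of_meanRoad_table)
open Summit.QuantumFields.BalabanUV.Beta.D1BFx.ShellRoadEndMean (d1Drift_of_meanRoad_table_shell)
open Summit.QuantumFields.BalabanUV.Beta.D1BFx.SbpScalarEndMean (d1Drift_of_meanRoad_table_sbp)
open Summit.QuantumFields.BalabanUV.Beta.RowD1TelescopingBounded (d1Drift_of_readoutBdd_D1Rep readoutBdd_of_D1Drift_D1Rep d1Rep_of_D1Drift_readoutBdd)

namespace Summit.QuantumFields.BalabanUV.Beta.GAN24.CombTowerEndRowD1MeanTable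

variable {Lc : ℕ} [NeZero Lc]

/-! ## §1 Road «BF-x»'s MEAN road ENDs in table currency at the (III′) literal of record — no slot row, no contact letter -/

/-- NOT IN PRINT; OUR BOOKKEEPING.  **THE MEAN ROAD END FOR THE (III′) LITERAL OF RECORD, TABLE CURRENCY, POINTWISE ROWS**: (B1_mean), the MEAN target
`(c (Lc^m) − Σ_b wt·fullSum (stK μ ν Nc (Gf (Lc^m) b)))∕m → 0` over a scalar leg family `Gf` with convex base-point weights, and an3's six graded scalar rows
`h0∕h1∕h2∕d0∕d1∕d2` for `Gf` ⟹ `D1Drift` at the (III′) literal (`D1BFx.RoadEnd.d1Drift_of_meanRoad_table` at HOLD §1). -/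
theorem d1Drift_JsB12CombShSym_an1_of_meanRoad_table (hLc : Odd Lc) (hLc2 : 2 ≤ Lc) {N : ℕ} (hN : 2 ≤ N) {cΛ cB : ℝ}
    (hΛ : cΛ * (Lc : ℝ) ^ 4 = 2) (hcB : cB = -((Lc : ℝ) ^ 12 / 4))
    {κB : Type*} {μ ν : Fin 4} (hμν : μ ≠ ν) {Nc : ℝ} (hNc : Nc ≠ 0) (c : ℕ → ℝ)
    {Bset : ℕ → Finset κB} {wt : ℕ → κB → ℝ} {Gf : ℕ → κB → Pt → ℝ} {D A : ℕ → ℝ}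
    (hD : ∀ j, 0 ≤ D j) (hA : ∀ j, 0 ≤ A j) {δ : ℝ} (hδ : 0 < δ)
    (hwt0 : ∀ n : ℕ, 2 ≤ n → ∀ b ∈ Bset n, 0 ≤ wt n b) (hwt1 : ∀ n : ℕ, 2 ≤ n → ∑ b ∈ Bset n, wt n b = 1)
    (h0 : ∀ n : ℕ, 2 ≤ n → ∀ b ∈ Bset n, ∀ v, |Gf n b v - gFree v| ≤ D 0 / (n : ℝ) ^ 2)
    (h1 : ∀ n : ℕ, 2 ≤ n → ∀ b ∈ Bset n, ∀ v (ρ : Fin 4),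
      |(Gf n b (v + unitVec ρ) - gFree (v + unitVec ρ)) - (Gf n b v - gFree v)| ≤ D 1 / (n : ℝ) ^ 3)
    (h2 : ∀ n : ℕ, 2 ≤ n → ∀ b ∈ Bset n, ∀ v,
      |(Gf n b (v + unitVec ν + unitVec μ) - gFree (v + unitVec ν + unitVec μ)) - (Gf n b (v + unitVec ν) - gFree (v + unitVec ν)) -
          (Gf n b (v + unitVec μ) - gFree (v + unitVec μ)) + (Gf n b v - gFree v)| ≤ D 2 / (n : ℝ) ^ 4)
    (d0 : ∀ n : ℕ, 2 ≤ n → ∀ b ∈ Bset n, ∀ v : Pt, v ≠ 0 → |Gf n b v| ≤ A 0 * Real.exp (-(δ / n) * supNorm v) / (supNorm v : ℝ) ^ 2)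
    (d1 : ∀ n : ℕ, 2 ≤ n → ∀ b ∈ Bset n, ∀ v : Pt, v ≠ 0 → ∀ ρ : Fin 4,
      |Gf n b (v + unitVec ρ) - Gf n b v| ≤ A 1 * Real.exp (-(δ / n) * supNorm v) / (supNorm v : ℝ) ^ 3)
    (d2 : ∀ n : ℕ, 2 ≤ n → ∀ b ∈ Bset n, ∀ v : Pt, v ≠ 0 →
      |Gf n b (v + unitVec ν + unitVec μ) - Gf n b (v + unitVec ν) - Gf n b (v + unitVec μ) + Gf n b v| ≤
        A 2 * Real.exp (-(δ / n) * supNorm v) / (supNorm v : ℝ) ^ 4)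
    (hB1 : Tendsto (fun m : ℕ =>
      ((∑ j ∈ range m, secondMoment (TbalOf Lc (JsB12CombShSym hLc N (symTablesAn1S2 3 Lc cΛ) cΛ cB) j) μ ν) - c (Lc ^ m)) / (m : ℝ))
      atTop (𝓝 0))
    (hT : Tendsto (fun m : ℕ => (c (Lc ^ m) - ∑ b ∈ Bset (Lc ^ m), wt (Lc ^ m) b * fullSum (stK μ ν Nc (Gf (Lc ^ m) b))) / (m : ℝ))
      atTop (𝓝 0)) :
    D1Drift Lc (JsB12CombShSym hLc N (symTablesAn1S2 3 Lc cΛ) cΛ cB) Nc μ ν := by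
  obtain ⟨κ, θ, hθ0, hθ1, hall⟩ := exists_allScalesSeq_JsB12CombShSym_an1 hLc hLc2 hN hΛ hcB μ ν
  exact d1Drift_of_meanRoad_table _ hμν hNc hLc2 hall hθ0 hθ1 c hD hA hδ hwt0 hwt1 h0 h1 h2 d0 d1 d2 hB1 hT

/-- NOT IN PRINT; OUR BOOKKEEPING.  **THE MEAN ROAD END FOR THE (III′) LITERAL OF RECORD, TABLE CURRENCY, SHELL FAR ROWS**: as the previous END with the mixed
second-difference rows h2 ∕ d2 in their SHELL-ℓ¹ forms `h2s` ∕ `d2s` (`D1BFx.ShellRoadEndMean.d1Drift_of_meanRoad_table_shell` at HOLD §1). -/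
theorem d1Drift_JsB12CombShSym_an1_of_meanRoad_table_shell (hLc : Odd Lc) (hLc2 : 2 ≤ Lc) {N : ℕ} (hN : 2 ≤ N) {cΛ cB : ℝ}
    (hΛ : cΛ * (Lc : ℝ) ^ 4 = 2) (hcB : cB = -((Lc : ℝ) ^ 12 / 4))
    {κB : Type*} {μ ν : Fin 4} (hμν : μ ≠ ν) {Nc : ℝ} (hNc : Nc ≠ 0) (c : ℕ → ℝ)
    {Bset : ℕ → Finset κB} {wt : ℕ → κB → ℝ} {Gf : ℕ → κB → Pt → ℝ} {D A : ℕ → ℝ}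
    (hD : ∀ j, 0 ≤ D j) (hA : ∀ j, 0 ≤ A j) {δ : ℝ} (hδ : 0 < δ)
    (hwt0 : ∀ n : ℕ, 2 ≤ n → ∀ b ∈ Bset n, 0 ≤ wt n b) (hwt1 : ∀ n : ℕ, 2 ≤ n → ∑ b ∈ Bset n, wt n b = 1)
    (h0 : ∀ n : ℕ, 2 ≤ n → ∀ b ∈ Bset n, ∀ v, |Gf n b v - gFree v| ≤ D 0 / (n : ℝ) ^ 2)
    (h1 : ∀ n : ℕ, 2 ≤ n → ∀ b ∈ Bset n, ∀ v (ρ : Fin 4),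
      |(Gf n b (v + unitVec ρ) - gFree (v + unitVec ρ)) - (Gf n b v - gFree v)| ≤ D 1 / (n : ℝ) ^ 3)
    (h2s : ∀ n : ℕ, 2 ≤ n → ∀ b ∈ Bset n, ∀ r : ℕ, r + 1 ≤ n →
      ∑ v ∈ annulus 4 r (r + 1), |(Gf n b (v + unitVec ν + unitVec μ) - gFree (v + unitVec ν + unitVec μ)) -
          (Gf n b (v + unitVec ν) - gFree (v + unitVec ν)) - (Gf n b (v + unitVec μ) - gFree (v + unitVec μ)) +
          (Gf n b v - gFree v)| ≤ D 2 / (n : ℝ))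
    (d0 : ∀ n : ℕ, 2 ≤ n → ∀ b ∈ Bset n, ∀ v : Pt, v ≠ 0 → |Gf n b v| ≤ A 0 * Real.exp (-(δ / n) * supNorm v) / (supNorm v : ℝ) ^ 2)
    (d1 : ∀ n : ℕ, 2 ≤ n → ∀ b ∈ Bset n, ∀ v : Pt, v ≠ 0 → ∀ ρ : Fin 4,
      |Gf n b (v + unitVec ρ) - Gf n b v| ≤ A 1 * Real.exp (-(δ / n) * supNorm v) / (supNorm v : ℝ) ^ 3)
    (d2s : ∀ n : ℕ, 2 ≤ n → ∀ b ∈ Bset n, ∀ r : ℕ, n ≤ r →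
      ∑ v ∈ annulus 4 r (r + 1), |Gf n b (v + unitVec ν + unitVec μ) - Gf n b (v + unitVec ν) - Gf n b (v + unitVec μ) + Gf n b v| ≤
        A 2 * Real.exp (-(δ / n) * ((r : ℝ) + 1)) / ((r : ℝ) + 1))
    (hB1 : Tendsto (fun m : ℕ =>
      ((∑ j ∈ range m, secondMoment (TbalOf Lc (JsB12CombShSym hLc N (symTablesAn1S2 3 Lc cΛ) cΛ cB) j) μ ν) - c (Lc ^ m)) / (m : ℝ))
      atTop (𝓝 0))
    (hT : Tendsto (fun m : ℕ => (c (Lc ^ m) - ∑ b ∈ Bset (Lc ^ m), wt (Lc ^ m) b * fullSum (stK μ ν Nc (Gf (Lc ^ m) b))) / (m : ℝ))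
      atTop (𝓝 0)) :
    D1Drift Lc (JsB12CombShSym hLc N (symTablesAn1S2 3 Lc cΛ) cΛ cB) Nc μ ν := by
  obtain ⟨κ, θ, hθ0, hθ1, hall⟩ := exists_allScalesSeq_JsB12CombShSym_an1 hLc hLc2 hN hΛ hcB μ ν
  exact d1Drift_of_meanRoad_table_shell _ hμν hNc hLc2 hall hθ0 hθ1 c hD hA hδ hwt0 hwt1 h0 h1 h2s d0 d1 d2s hB1 hT


/-- NOT IN PRINT; OUR BOOKKEEPING.  **THE MEAN ROAD END FOR THE (III′) LITERAL OF RECORD, TABLE CURRENCY, NO SECOND-DIFFERENCE ROW («C3-SBP»)**: (B1_mean), the MEAN target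
`(c (Lc^m) − Σ_b wt·fullSum (stK μ ν Nc (Gf (Lc^m) b)))∕m → 0` over a scalar leg family `Gf` with convex base-point weights, and the FOUR first-order rows `h0`∕`h1`∕`d0`∕`d1`
⟹ `D1Drift` at the (III′) literal (`D1BFx.SbpScalarEndMean.d1Drift_of_meanRoad_table_sbp` at HOLD §1) — the (III′) twin of J-54 §2 `d1Drift_JsRowD1Pin_of_meanRoad_table_sbp`. -/
theorem d1Drift_JsB12CombShSym_an1_of_meanRoad_table_sbp (hLc : Odd Lc) (hLc2 : 2 ≤ Lc) {N : ℕ} (hN : 2 ≤ N) {cΛ cB : ℝ}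
    (hΛ : cΛ * (Lc : ℝ) ^ 4 = 2) (hcB : cB = -((Lc : ℝ) ^ 12 / 4))
    {κB : Type*} {μ ν : Fin 4} (hμν : μ ≠ ν) {Nc : ℝ} (hNc : Nc ≠ 0) (c : ℕ → ℝ)
    {Bset : ℕ → Finset κB} {wt : ℕ → κB → ℝ} {Gf : ℕ → κB → Pt → ℝ} {D A : ℕ → ℝ}
    (hD : ∀ j, 0 ≤ D j) (hA : ∀ j, 0 ≤ A j) {δ : ℝ} (hδ : 0 < δ)
    (hwt0 : ∀ n : ℕ, 2 ≤ n → ∀ b ∈ Bset n, 0 ≤ wt n b) (hwt1 : ∀ n : ℕ, 2 ≤ n → ∑ b ∈ Bset n, wt n b = 1)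
    (h0 : ∀ n : ℕ, 2 ≤ n → ∀ b ∈ Bset n, ∀ v, |Gf n b v - gFree v| ≤ D 0 / (n : ℝ) ^ 2)
    (h1 : ∀ n : ℕ, 2 ≤ n → ∀ b ∈ Bset n, ∀ v (ρ : Fin 4),
      |(Gf n b (v + unitVec ρ) - gFree (v + unitVec ρ)) - (Gf n b v - gFree v)| ≤ D 1 / (n : ℝ) ^ 3)
    (d0 : ∀ n : ℕ, 2 ≤ n → ∀ b ∈ Bset n, ∀ v : Pt, v ≠ 0 → |Gf n b v| ≤ A 0 * Real.exp (-(δ / n) * supNorm v) / (supNorm v : ℝ) ^ 2)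
    (d1 : ∀ n : ℕ, 2 ≤ n → ∀ b ∈ Bset n, ∀ v : Pt, v ≠ 0 → ∀ ρ : Fin 4,
      |Gf n b (v + unitVec ρ) - Gf n b v| ≤ A 1 * Real.exp (-(δ / n) * supNorm v) / (supNorm v : ℝ) ^ 3)
    (hB1 : Tendsto (fun m : ℕ =>
      ((∑ j ∈ range m, secondMoment (TbalOf Lc (JsB12CombShSym hLc N (symTablesAn1S2 3 Lc cΛ) cΛ cB) j) μ ν) - c (Lc ^ m)) / (m : ℝ))
      atTop (𝓝 0))
    (hT : Tendsto (fun m : ℕ => (c (Lc ^ m) - ∑ b ∈ Bset (Lc ^ m), wt (Lc ^ m) b * fullSum (stK μ ν Nc (Gf (Lc ^ m) b))) / (m : ℝ))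
      atTop (𝓝 0)) :
    D1Drift Lc (JsB12CombShSym hLc N (symTablesAn1S2 3 Lc cΛ) cΛ cB) Nc μ ν := by
  obtain ⟨κ, θ, hθ0, hθ1, hall⟩ := exists_allScalesSeq_JsB12CombShSym_an1 hLc hLc2 hN hΛ hcB μ ν
  exact d1Drift_of_meanRoad_table_sbp _ hμν hNc hLc2 hall hθ0 hθ1 c hD hA hδ hwt0 hwt1 h0 h1 d0 d1 hB1 hT

/-! ## §2 an2's «two out of three» for the (III′) literal of record, ANY composite family `Jc`, WITHOUT any half-kernel letter -/

/-- [folklore] **GIVEN `D1Rep Lc Jc …` FOR A COMPOSITE FAMILY `Jc`, THE BOUNDED READ-OUT DEFECT OF `β⁰` AGAINST `TshotOf Lc Jc` ⟺ THE SCALAR IDENTIFICATION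
`CauchyRate.lim β⁰ = stepBal Nc Lc`** — an2's generic `RowD1TelescopingBounded.d1Drift_of_readoutBdd_D1Rep` ∕ `readoutBdd_of_D1Drift_D1Rep` (standing data: the printed B5 Props BY
NAME, labels, channel `μ ≠ ν`, colour `Nc ≠ 0`, window) composed with HOLD §2 BY NAME.  `Jc` is DISPLAYED (the (III′) literal has no composite family of record in the tree); neither side
is proved; `D1Rep` (EXIT-A) is row D1's. -/
theorem readoutBdd_iff_lim_eq_of_D1Rep {L : Type*} (hLc : Odd Lc) (hLc2 : 2 ≤ Lc) {N : ℕ} (hN : 2 ≤ N) {cΛ cB : ℝ}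
    (hΛ : cΛ * (Lc : ℝ) ^ 4 = 2) (hcB : cB = -((Lc : ℝ) ^ 12 / 4))
    (a : ℝ) (ha : 0 < a)
    (h12 : B5.Prop12Printed (fam (fun i : ℕ+ × ℕ => ((i.1 : ℕ+) : ℕ)) (fun i => i.1.pos) MvE a ha))
    (h126 : B5.Kernel126_127Printed (kfam (fun i : ℕ+ × ℕ => ((i.1 : ℕ+) : ℕ)) MvE))
    {SL : Finset L} (hSL : SL.Nonempty) (k : L → Fin 4) {μ ν : Fin 4} (hμν : μ ≠ ν) {Nc : ℝ} (hNc : Nc ≠ 0)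
    {cc : ℝ} {M : ℕ → ℕ} (hc : 1 ≤ cc) (hMw : ∀ L : ℕ, 2 ≤ L → 1 ≤ M L ∧ (L : ℝ) ≤ cc * M L) (hML : ∀ L : ℕ, 2 ≤ L → M L ≤ L)
    (Jc : ∀ m : ℕ, JetData 3 (Lc ^ m)) (hrep : D1Rep Lc Jc Nc μ ν a SL k) :
    (∃ U' : ℝ, ∀ m : ℕ, 1 ≤ m →
      |∑ j ∈ range m, secondMoment (TbalOf Lc (JsB12CombShSym hLc N (symTablesAn1S2 3 Lc cΛ) cΛ cB) j) μ ν - secondMoment (TshotOf Lc Jc m) μ ν| ≤ U') ↔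
      CauchyRate.lim (fun j => secondMoment (TbalOf Lc (JsB12CombShSym hLc N (symTablesAn1S2 3 Lc cΛ) cΛ cB) j) μ ν) = stepBal Nc Lc := by
  rw [← d1Drift_JsB12CombShSym_an1_iff_lim_eq hLc hLc2 hN hΛ hcB μ ν Nc]
  exact ⟨fun h => d1Drift_of_readoutBdd_D1Rep a ha h12 h126 hSL k hμν hNc hLc2 _ Jc h hc hMw hML hrep,
    fun hD => readoutBdd_of_D1Drift_D1Rep a ha h12 h126 hSL k hμν hNc hLc2 _ Jc hc hMw hML hD hrep⟩

/-- [folklore] **AND GIVEN THE IDENTIFICATION, `D1Rep Lc Jc …` IS EQUIVALENT TO THE BOUNDED READ-OUT DEFECT** for every composite family `Jc` — so at the (III′) literal the two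
open clauses of row D1 are tied by HOLD: whichever road closes `lim β⁰ = stepBal Nc Lc` turns `D1Rep` into a consequence of the bounded read-out defect, and conversely
(`RowD1TelescopingBounded.d1Rep_of_D1Drift_readoutBdd` ∕ `readoutBdd_of_D1Drift_D1Rep` ⨾ HOLD §2). -/
theorem d1Rep_iff_readoutBdd_of_lim_eq {L : Type*} (hLc : Odd Lc) (hLc2 : 2 ≤ Lc) {N : ℕ} (hN : 2 ≤ N) {cΛ cB : ℝ}
    (hΛ : cΛ * (Lc : ℝ) ^ 4 = 2) (hcB : cB = -((Lc : ℝ) ^ 12 / 4))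
    (a : ℝ) (ha : 0 < a)
    (h12 : B5.Prop12Printed (fam (fun i : ℕ+ × ℕ => ((i.1 : ℕ+) : ℕ)) (fun i => i.1.pos) MvE a ha))
    (h126 : B5.Kernel126_127Printed (kfam (fun i : ℕ+ × ℕ => ((i.1 : ℕ+) : ℕ)) MvE))
    {SL : Finset L} (hSL : SL.Nonempty) (k : L → Fin 4) {μ ν : Fin 4} (hμν : μ ≠ ν) {Nc : ℝ} (hNc : Nc ≠ 0)
    {cc : ℝ} {M : ℕ → ℕ} (hc : 1 ≤ cc) (hMw : ∀ L : ℕ, 2 ≤ L → 1 ≤ M L ∧ (L : ℝ) ≤ cc * M L) (hML : ∀ L : ℕ, 2 ≤ L → M L ≤ L)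
    (Jc : ∀ m : ℕ, JetData 3 (Lc ^ m))
    (hI : CauchyRate.lim (fun j => secondMoment (TbalOf Lc (JsB12CombShSym hLc N (symTablesAn1S2 3 Lc cΛ) cΛ cB) j) μ ν) = stepBal Nc Lc) :
    D1Rep Lc Jc Nc μ ν a SL k ↔
      ∃ U' : ℝ, ∀ m : ℕ, 1 ≤ m →
        |∑ j ∈ range m, secondMoment (TbalOf Lc (JsB12CombShSym hLc N (symTablesAn1S2 3 Lc cΛ) cΛ cB) j) μ ν - secondMoment (TshotOf Lc Jc m) μ ν| ≤ U' := by
  have hD : D1Drift Lc (JsB12CombShSym hLc N (symTablesAn1S2 3 Lc cΛ) cΛ cB) Nc μ ν :=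
    (d1Drift_JsB12CombShSym_an1_iff_lim_eq hLc hLc2 hN hΛ hcB μ ν Nc).2 hI
  exact ⟨fun hrep => readoutBdd_of_D1Drift_D1Rep a ha h12 h126 hSL k hμν hNc hLc2 _ Jc hc hMw hML hD hrep,
    fun h => d1Rep_of_D1Drift_readoutBdd a ha h12 h126 hSL k hμν hNc hLc2 _ Jc hc hMw hML hD h⟩

end Summit.QuantumFields.BalabanUV.Beta.GAN24.CombTowerEndRowD1MeanTable

end
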